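import Mathlib
import HarnessLib
import Literature.Analysis.FluidPDE.ClassicalSolution
import Literature.Analysis.FluidPDE.LerayHopf
import Literature.Analysis.FluidPDE.SuitableWeak
import Summits.NavierStokesRegularity.NavierStokesRegularity.Theses.QuarterJolt
import Summits.NavierStokesRegularity.NavierStokesRegularity.Theorems.QuarterJoltTypeIEnergyEquality
import Summits.NavierStokesRegularity.NavierStokesRegularity.Theorems.QuarterJoltEnergyJumpPosition
import Summits.NavierStokesRegularity.NavierStokesRegularity.Theorems.QuarterJoltTypeIJoltLaw

/-!
# Route QuarterJolt — crux `NoTerminalJolt` (stmt-NavierStokesRegularity-26463), LEAD line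
# `regular_split` rev 5: POSITION after the Type-I energy equality

Seat ns-ntj-p1 g4 (LEAD of the crux; `--supports 26463 --as helper`). Companion of
`QuarterJoltTypeIEnergyEquality.lean` (Type-I rate at `T` ⇒ `‖u(t) − u(T)‖_{L²} → 0`): by-name
consequences for the registry's readers.

* `noFastEnergyConcentration_of_isTypeIBlowup` — the conclusion of shelf statement stmt-18118
  (`HodographBetchov.NoFastEnergyConcentration`: uniform integrability of the kinetic energy over
  speed classes up to `T`) holds for every frame solution with the Type-I rate at `T`
  (`FastClassSqueeze.Birth.stub_no_fast_energy_concentration_of_tendsto`).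
* `typeI_jumpFree_jolt` — a Type-I FIRST blow-up is a JUMP-FREE JOLT: strong `L²`-continuity into `T`
  and yet `(√(T−t))⁻¹∫‖u(t) − u(T)‖² ↛ 0` (Type-I terminal jolt law `typeI_terminalJoltLaw`, p629148).
* `typeIIEnergyEquality_iff_energyEqualityAtBlowup` — stub `stub_typeIIEnergyEquality` of
  `Cruxes/NoTerminalJolt/Lines/regular_split.lean` is EXACTLY «no energy jump at ANY first blow-up of
  the frame» (Leray's energy equality at first blow-up times); rev-5 exactness
  `iff_noTypeIBlowup_and_energyEqualityAtBlowup_and_typeIIRate`: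
  `NoTerminalJolt ⟺ NoTypeIBlowup (1217) ∧ EnergyEqualityAtBlowup ∧ TypeIIRate`.

HONEST FRAMING: no Type-I blow-up is known to exist (stmt-1217 says none does); `NoTerminalJolt`,
`NoTypeIBlowup`, the energy equality at first blow-up times, `NoFastEnergyConcentration` and
Navier–Stokes regularity are OPEN; nothing here claims progress on them. No summit statement is proved
here. [folklore]
-/

noncomputable section

-- the summit and its single sub-problem share the name (CONVENTIONS §1), as in every Theorems file
set_option linter.dupNamespace false

namespace Summit.NavierStokesRegularity.NavierStokesRegularity.Theorems

open MeasureTheory Set Function Filter Topology InnerProductSpace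
open scoped ENNReal NNReal ContDiff RealInnerProductSpace
open Literature.Analysis.FluidPDE

namespace NoTerminalJolt

/-- **Type-I blow-up: no fast energy concentration** (the conclusion of shelf statement stmt-18118
`HodographBetchov.NoFastEnergyConcentration` for THIS solution: the kinetic energy is uniformly
integrable over speed classes up to `T`), via the landed
`FastClassSqueeze.Birth.stub_no_fast_energy_concentration_of_tendsto`. [folklore] -/
theorem noFastEnergyConcentration_of_isTypeIBlowup {ν T : ℝ} (hν : 0 < ν) (hT : 0 < T)
    {u : ℝ → EuclideanSpace ℝ (Fin 3) → EuclideanSpace ℝ (Fin 3)} {p : ℝ → EuclideanSpace ℝ (Fin 3) → ℝ}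
    (hcl : IsClassicalNSSolutionOn (Ico 0 T) ν 0 u p) (hLH : IsLerayHopfOn T ν 0 (u 0) u)
    (hdec : HasRapidSpatialDecay (u 0)) (hTI : IsTypeIBlowup u T) :
    ∀ ε : ℝ, 0 < ε → ∃ l : ℝ, 0 < l ∧ ∀ t ∈ Set.Ico 0 T,
      ∫⁻ x in {x : EuclideanSpace ℝ (Fin 3) | l < ‖u t x‖}, ‖u t x‖ₑ ^ 2 ≤ ENNReal.ofReal ε :=
  FastClassSqueeze.Birth.stub_no_fast_energy_concentration_of_tendsto ν T hν hT u p hcl hLH hdec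
    (tendsto_eLpNorm_sub_of_isTypeIBlowup hν hT hcl hLH hdec hTI)

/-! ### At a Type-I FIRST blow-up: a jump-free jolt -/

/-- **A Type-I first blow-up is a JUMP-FREE JOLT.** If `(u,p)` is a MAXIMAL classical solution with
lifespan `T` (no smooth extension past `T`), Leray–Hopf on `[0,T]` from a rapidly decaying datum, with
the Type-I rate at `T`, then (i) the energy is continuous at `T` (`∫‖u(t) − u(T)‖² → 0`, this file) and
yet (ii) the jolt functional `(√(T−t))⁻¹∫‖u(t) − u(T)‖²` does NOT tend to `0` (the Type-I terminal
jolt law `typeI_terminalJoltLaw`, p629148): the approach to the terminal value is strong in `L²` but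
not `o((T−t)^{1/4})`. (Hypothetical: no Type-I blow-up is known to exist; shelf item stmt-1217 says
there is none.) [folklore] -/
theorem typeI_jumpFree_jolt {ν T : ℝ} (hν : 0 < ν) (hT : 0 < T)
    {u : ℝ → EuclideanSpace ℝ (Fin 3) → EuclideanSpace ℝ (Fin 3)} {p : ℝ → EuclideanSpace ℝ (Fin 3) → ℝ}
    (hmax : IsMaximalSmoothSolution ν 0 u p T) (hLH : IsLerayHopfOn T ν 0 (u 0) u)
    (hdec : HasRapidSpatialDecay (u 0)) (hTI : IsTypeIBlowup u T) :
    Tendsto (fun t => ∫ x, ‖u t x - u T x‖ ^ 2) (𝓝[<] T) (𝓝 0) ∧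
      ¬ Tendsto (fun t : ℝ => (Real.sqrt (T - t))⁻¹ * ∫ x, ‖u t x - u T x‖ ^ 2)
        (𝓝[<] T) (𝓝 0) :=
  ⟨tendsto_integral_norm_sub_sq_of_isTypeIBlowup hν hT hmax.1 hLH hdec hTI,
    typeI_terminalJoltLaw hν hT hmax hLH hdec hTI⟩

/-! ### Position for the skeleton rev 5: stub 3 is «no energy jump at ANY first blow-up» -/

/-- **`TypeIIEnergyEquality ⟺ EnergyEqualityAtBlowup`.** The statement of stub
`stub_typeIIEnergyEquality` of `Cruxes/NoTerminalJolt/Lines/regular_split.lean` («a NON-Type-I first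
blow-up in the frame has no energy jump at `T`») is equivalent to the same statement WITHOUT the
non-Type-I hypothesis («EVERY first blow-up in the frame has no energy jump at `T`», i.e. Leray's
energy equality on `[0,T]` at every first blow-up time, `tendsto_eLpNorm_sub_iff_energyEquality`):
the Type-I case is the theorem `tendsto_eLpNorm_sub_of_isTypeIBlowup`. Both sides are OPEN
statements; nothing is asserted about them. [folklore] -/
theorem typeIIEnergyEquality_iff_energyEqualityAtBlowup :
    (∀ (ν T : ℝ), 0 < ν → 0 < T →
      ∀ (u : ℝ → EuclideanSpace ℝ (Fin 3) → EuclideanSpace ℝ (Fin 3))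
        (p : ℝ → EuclideanSpace ℝ (Fin 3) → ℝ),
        Literature.Analysis.FluidPDE.IsMaximalSmoothSolution ν 0 u p T →
        Literature.Analysis.FluidPDE.IsLerayHopfOn T ν 0 (u 0) u →
        Literature.Analysis.FluidPDE.HasRapidSpatialDecay (u 0) →
        ¬ Literature.Analysis.FluidPDE.IsTypeIBlowup u T →
        Filter.Tendsto (fun t => MeasureTheory.eLpNorm (u t - u T) 2 MeasureTheory.volume)
          (nhdsWithin T (Set.Iio T)) (nhds 0)) ↔
    (∀ (ν T : ℝ), 0 < ν → 0 < T →
      ∀ (u : ℝ → EuclideanSpace ℝ (Fin 3) → EuclideanSpace ℝ (Fin 3))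
        (p : ℝ → EuclideanSpace ℝ (Fin 3) → ℝ),
        Literature.Analysis.FluidPDE.IsMaximalSmoothSolution ν 0 u p T →
        Literature.Analysis.FluidPDE.IsLerayHopfOn T ν 0 (u 0) u →
        Literature.Analysis.FluidPDE.HasRapidSpatialDecay (u 0) →
        Filter.Tendsto (fun t => MeasureTheory.eLpNorm (u t - u T) 2 MeasureTheory.volume)
          (nhdsWithin T (Set.Iio T)) (nhds 0)) := by
  refine ⟨fun h ν T hν hT u p hmax hLH hdec => ?_,
    fun h ν T hν hT u p hmax hLH hdec _ => h ν T hν hT u p hmax hLH hdec⟩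
  by_cases hTI : IsTypeIBlowup u T
  · exact tendsto_eLpNorm_sub_of_isTypeIBlowup hν hT hmax.1 hLH hdec hTI
  · exact h ν T hν hT u p hmax hLH hdec hTI

/-- **`NoTerminalJolt ⟺ NoTypeIBlowup ∧ EnergyEqualityAtBlowup ∧ TypeIIRate`** — exactness of the
skeleton `regular_split` rev 5: the crux BY NAME is equivalent to the conjunction of the shelf
statement stmt-1217 (`NoTypeIBlowup`, verbatim), «no energy jump at any first blow-up of the frame»
(Leray's energy equality at first blow-up times) and the Type-II rate statement
(`iff_noTypeIBlowup_and_typeIIEnergyEquality_and_typeIIRate`, p632467, with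
`typeIIEnergyEquality_iff_energyEqualityAtBlowup`). All conjuncts are OPEN; nothing is asserted about
them. [folklore] -/
theorem iff_noTypeIBlowup_and_energyEqualityAtBlowup_and_typeIIRate :
    Theses.QuarterJolt.NoTerminalJolt ↔
      ((∀ (ν T : ℝ), 0 < ν → 0 < T →
        ∀ (u : ℝ → EuclideanSpace ℝ (Fin 3) → EuclideanSpace ℝ (Fin 3))
          (p : ℝ → EuclideanSpace ℝ (Fin 3) → ℝ),
          Literature.Analysis.FluidPDE.IsClassicalNSSolutionOn (Set.Ico 0 T) ν 0 u p →
          Literature.Analysis.FluidPDE.IsLerayHopfOn T ν 0 (u 0) u →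
          Literature.Analysis.FluidPDE.HasRapidSpatialDecay (u 0) →
          Literature.Analysis.FluidPDE.IsTypeIBlowup u T →
          Literature.Analysis.FluidPDE.HasSmoothExtensionPast ν 0 u T) ∧
      (∀ (ν T : ℝ), 0 < ν → 0 < T →
        ∀ (u : ℝ → EuclideanSpace ℝ (Fin 3) → EuclideanSpace ℝ (Fin 3))
          (p : ℝ → EuclideanSpace ℝ (Fin 3) → ℝ),
          Literature.Analysis.FluidPDE.IsMaximalSmoothSolution ν 0 u p T →
          Literature.Analysis.FluidPDE.IsLerayHopfOn T ν 0 (u 0) u →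
          Literature.Analysis.FluidPDE.HasRapidSpatialDecay (u 0) →
          Filter.Tendsto (fun t => MeasureTheory.eLpNorm (u t - u T) 2 MeasureTheory.volume)
            (nhdsWithin T (Set.Iio T)) (nhds 0)) ∧
      (∀ (ν T : ℝ), 0 < ν → 0 < T →
        ∀ (u : ℝ → EuclideanSpace ℝ (Fin 3) → EuclideanSpace ℝ (Fin 3))
          (p : ℝ → EuclideanSpace ℝ (Fin 3) → ℝ),
          Literature.Analysis.FluidPDE.IsMaximalSmoothSolution ν 0 u p T →
          Literature.Analysis.FluidPDE.IsLerayHopfOn T ν 0 (u 0) u →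
          Literature.Analysis.FluidPDE.HasRapidSpatialDecay (u 0) →
          ¬ Literature.Analysis.FluidPDE.IsTypeIBlowup u T →
          Filter.Tendsto (fun t => MeasureTheory.eLpNorm (u t - u T) 2 MeasureTheory.volume)
            (nhdsWithin T (Set.Iio T)) (nhds 0) →
          Filter.Tendsto (fun t : ℝ => (Real.sqrt (T - t))⁻¹ * ∫ x, ‖u t x - u T x‖ ^ 2)
            (nhdsWithin T (Set.Iio T)) (nhds 0))) := by
  rw [iff_noTypeIBlowup_and_typeIIEnergyEquality_and_typeIIRate,
    typeIIEnergyEquality_iff_energyEqualityAtBlowup]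

/-- **`NoTerminalJolt ⇒` Type-I first blow-ups do not exist, and every OTHER first blow-up of the
frame is energy-continuous and jolt-free** — restatement for the registry's readers of what the crux
BY NAME says at blow-up times after rev 5 (nothing new is asserted; the crux is OPEN). [folklore] -/
theorem energyEqualityAtBlowup_of_noTerminalJolt (h : Theses.QuarterJolt.NoTerminalJolt) :
    ∀ (ν T : ℝ), 0 < ν → 0 < T →
      ∀ (u : ℝ → EuclideanSpace ℝ (Fin 3) → EuclideanSpace ℝ (Fin 3))
        (p : ℝ → EuclideanSpace ℝ (Fin 3) → ℝ),
        Literature.Analysis.FluidPDE.IsMaximalSmoothSolution ν 0 u p T →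
        Literature.Analysis.FluidPDE.IsLerayHopfOn T ν 0 (u 0) u →
        Literature.Analysis.FluidPDE.HasRapidSpatialDecay (u 0) →
        Filter.Tendsto (fun t => MeasureTheory.eLpNorm (u t - u T) 2 MeasureTheory.volume)
          (nhdsWithin T (Set.Iio T)) (nhds 0) :=
  (iff_noTypeIBlowup_and_energyEqualityAtBlowup_and_typeIIRate.1 h).2.1

end NoTerminalJolt

end Summit.NavierStokesRegularity.NavierStokesRegularity.Theorems

end
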